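import Summits.ResolutionOfSingularities.ResolutionOfSingularities.Theses.UniformComplexity
import Summits.ResolutionOfSingularities.ResolutionOfSingularities.Theorems.UniformComplexityPrimeModelTransferAlgClosureFgTower
import Summits.ResolutionOfSingularities.ResolutionOfSingularities.Theorems.UniversalCellsCampaignW82FamilyTransferGradedProofs
import HarnessLib

/-!
# Crux `PrimeModelTransfer` (stmt-ResolutionOfSingularities-8933) from the kernel at the
# algebraically closed fields OF FINITE TRANSCENDENCE DEGREE `(𝔽_p(s))^{alg} ∩ K`

Route `ResolutionOfSingularities/UniformComplexity`, crux `PrimeModelTransfer` (stmt-8933). Leaf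
file (imports the route file directly and otherwise only the Theses-free pinned tower
`Theorems/UniformComplexityPrimeModelTransferAlgClosureFgTower.lean`).

`Theorems.PrimeModelTransfer.primeModelTransfer_of_climbAlgClosed` (p470915) derived the crux from
the shared transfer kernel restricted to ALGEBRAICALLY CLOSED constant fields `M`. **This file
sharpens the restriction to the fields the induction actually visits**: `M = (closure s)^{alg} ∩ K`
for `K` algebraically closed of characteristic `p` and `s ⊆ K` finite — the algebraically closed
fields of FINITE transcendence degree over `𝔽_p`, presented inside `K` (up to isomorphism: the
countably many fields `(𝔽_p(t₁, …, t_n))^{alg}`, `n ≥ 0`).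

* `primeModelTransfer_of_climbAlgClosureFg` — `PrimeModelTransfer` ⇐ the kernel at those `M`
  (pinned tower `hasResolution_algebraicClosure_closure` + descent `hasResolution_of_perfectSubfields`);
* `climbAlgClosureFg_of_climbAlgClosed` — the restriction is implied by the kernel at all
  algebraically closed `M` (instantiation), so this refines p470915, which refines p461439.

So, kernel-checked: door 2 of the W8.2 lever (`𝔽_p`-bar ⇒ every algebraically closed field of
characteristic `p`) asks for the one-transcendental climb `M ⇒ M(t)^{perf}` only at the constant
fields `M = (𝔽_p(t₁,…,t_n))^{alg}`; everything else (limit step, descent, the algebraic part of each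
climb) is proved. The fibre form of that climb is barrier-dead
(`Literature.Barriers.ResolutionOfSingularities.InseparableBaseChangeResolution.not_isRegular_stable_groundFieldExtension`,
`…RegularNotGeometricallyRegular`, `…FrobeniusTwistResolution`); the family form (regular total
space over `M`) is what the hypothesis supplies.

[OURS · LADDER-RESOLUTION L1, slot W8.2 (prime-field / universality transfer), door 2
UniformComplexity] Reductions over the summit's own route; NOT statements of, and attributing
nothing to, Hironaka's 2017 manuscript.

Sources: Stacks Project 09GI, 030A; Q. Liu, *Algebraic Geometry and Arithmetic Curves* (2002),
Cor. 4.3.33. [cite: Liu2002, Cor. 4.3.33]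
-/

noncomputable section

set_option linter.dupNamespace false -- mandated namespace of this single-conjunct summit

open CategoryTheory CategoryTheory.Limits AlgebraicGeometry TopologicalSpace
open Literature.AlgebraicGeometry.Resolution

namespace Summit.ResolutionOfSingularities.ResolutionOfSingularities.Theorems.PrimeModelTransfer

/-- **`PrimeModelTransfer` from the kernel at the algebraically closed fields of finite
transcendence degree.** If, for every prime `p`, every algebraically closed `K` of characteristic
`p` and every finite `s ⊆ K`, resolution of all integral separated schemes of finite type over
`M := (closure s)^{alg} ∩ K` implies the same over every perfect field purely inseparable over
`RatFunc M`, then `UniformComplexity.PrimeModelTransfer` holds: every finite `S ⊆ K` lies in the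
perfect subfield `(closure S)^{alg} ∩ K`, over which resolution holds by the pinned tower
(`hasResolution_algebraicClosure_closure`), and resolution descends to `K`
(`hasResolution_of_perfectSubfields`). [folklore] -/
theorem primeModelTransfer_of_climbAlgClosureFg
    (hker : ∀ p : ℕ, p.Prime → ∀ (K : Type) [Field K] [CharP K p] [IsAlgClosed K] (s : Finset K),
      (∀ (X : Scheme.{0})
        (f : X ⟶ Spec (.of (algebraicClosure (Subfield.closure (↑s : Set K)) K))),
        IsSeparated f → LocallyOfFiniteType f → QuasiCompact f → IsIntegral X →
          Scheme.HasResolution X) →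
      ∀ (L : Type) [Field L] [PerfectField L]
        [Algebra (RatFunc (algebraicClosure (Subfield.closure (↑s : Set K)) K)) L]
        [IsPurelyInseparable (RatFunc (algebraicClosure (Subfield.closure (↑s : Set K)) K)) L]
        (X : Scheme.{0}) (f : X ⟶ Spec (.of L)), IsSeparated f → LocallyOfFiniteType f →
          QuasiCompact f → IsIntegral X → Scheme.HasResolution X) :
    Summit.ResolutionOfSingularities.ResolutionOfSingularities.Theses.UniformComplexity.PrimeModelTransfer := by
  intro p hp hA K _ _ _ X f hs hl hq hX
  classical
  haveI : Fact p.Prime := ⟨hp⟩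
  haveI : PerfectField K := IsAlgClosed.perfectField K
  refine hasResolution_of_perfectSubfields K (fun s => ?_) X f hs hl hq hX
  let F : Subfield K := Subfield.closure (↑s : Set K)
  let A : IntermediateField F K := algebraicClosure F K
  haveI : IsAlgClosed A := IsAlgClosure.isAlgClosed F
  refine ⟨A.toSubfield, fun x hx => ?_, inferInstanceAs (PerfectField A), ?_⟩
  · exact A.algebraMap_mem (⟨x, Subfield.subset_closure hx⟩ : F)
  · exact fun Y g hs' hl' hq' hY =>
      hasResolution_algebraicClosure_closure p K (fun k _ _ _ hk => hA k hk) (hker p hp K) s Y g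
        hs' hl' hq' hY

/-- **The finite-transcendence-degree restriction is implied by the kernel at all algebraically
closed constant fields** (instantiation at `M = (closure s)^{alg} ∩ K`): so
`primeModelTransfer_of_climbAlgClosureFg` refines `primeModelTransfer_of_climbAlgClosed` (p470915).
[folklore] -/
theorem climbAlgClosureFg_of_climbAlgClosed
    (hker : ∀ p : ℕ, p.Prime → ∀ (M : Type) [Field M] [CharP M p] [IsAlgClosed M],
      (∀ (X : Scheme.{0}) (f : X ⟶ Spec (.of M)), IsSeparated f → LocallyOfFiniteType f →
        QuasiCompact f → IsIntegral X → Scheme.HasResolution X) →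
      ∀ (L : Type) [Field L] [PerfectField L] [Algebra (RatFunc M) L]
        [IsPurelyInseparable (RatFunc M) L]
        (X : Scheme.{0}) (f : X ⟶ Spec (.of L)), IsSeparated f → LocallyOfFiniteType f →
          QuasiCompact f → IsIntegral X → Scheme.HasResolution X) :
    ∀ p : ℕ, p.Prime → ∀ (K : Type) [Field K] [CharP K p] [IsAlgClosed K] (s : Finset K),
      (∀ (X : Scheme.{0})
        (f : X ⟶ Spec (.of (algebraicClosure (Subfield.closure (↑s : Set K)) K))),
        IsSeparated f → LocallyOfFiniteType f → QuasiCompact f → IsIntegral X →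
          Scheme.HasResolution X) →
      ∀ (L : Type) [Field L] [PerfectField L]
        [Algebra (RatFunc (algebraicClosure (Subfield.closure (↑s : Set K)) K)) L]
        [IsPurelyInseparable (RatFunc (algebraicClosure (Subfield.closure (↑s : Set K)) K)) L]
        (X : Scheme.{0}) (f : X ⟶ Spec (.of L)), IsSeparated f → LocallyOfFiniteType f →
          QuasiCompact f → IsIntegral X → Scheme.HasResolution X := by
  intro p hp K _ _ _ s hM L _ _ _ _ X f hs hl hq hX
  let F : Subfield K := Subfield.closure (↑s : Set K)
  haveI : IsAlgClosed (algebraicClosure F K) := IsAlgClosure.isAlgClosed F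
  haveI : CharP (algebraicClosure F K) p :=
    (algebraMap (algebraicClosure F K) K).charP (algebraMap (algebraicClosure F K) K).injective p
  exact hker p hp (algebraicClosure F K) hM L X f hs hl hq hX

/-- **`PrimeModelTransfer` from the PERFECTION STEP at the algebraically closed fields of finite
transcendence degree** (appended; uses res-L1-s82-pv-1's finite-level family transfer
`CampaignW82.spreadOutRatFuncDimLe_top_top`, p475166, which holds over EVERY constant field). If, for
every prime `p`, every algebraically closed `K` of characteristic `p` and every finite `s ⊆ K`,
resolution of all integral separated schemes of finite type over `RatFunc M`,
`M := (closure s)^{alg} ∩ K`, implies the same over every perfect field purely inseparable over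
`RatFunc M`, then `UniformComplexity.PrimeModelTransfer` holds: the kernel at `M` is the family
transfer `Res(M) ⇒ Res(RatFunc M)` (a theorem) followed by this perfection step, and
`primeModelTransfer_of_climbAlgClosureFg` applies. This is the sharpest door-2 residual on file:
the passage «regular model over `M(t)` ⇒ model smooth over some `M(t^{1/p^e})`» at the countably
many constant fields `M = (𝔽_p(t₁,…,t_n))^{alg}`. [folklore] -/
theorem primeModelTransfer_of_perfectionStepAlgClosureFg
    (hperf : ∀ p : ℕ, p.Prime → ∀ (K : Type) [Field K] [CharP K p] [IsAlgClosed K] (s : Finset K),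
      (∀ (X : Scheme.{0})
        (f : X ⟶ Spec (.of (RatFunc (algebraicClosure (Subfield.closure (↑s : Set K)) K)))),
        IsSeparated f → LocallyOfFiniteType f → QuasiCompact f → IsIntegral X →
          Scheme.HasResolution X) →
      ∀ (L : Type) [Field L] [PerfectField L]
        [Algebra (RatFunc (algebraicClosure (Subfield.closure (↑s : Set K)) K)) L]
        [IsPurelyInseparable (RatFunc (algebraicClosure (Subfield.closure (↑s : Set K)) K)) L]
        (X : Scheme.{0}) (f : X ⟶ Spec (.of L)), IsSeparated f → LocallyOfFiniteType f →
          QuasiCompact f → IsIntegral X → Scheme.HasResolution X) :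
    Summit.ResolutionOfSingularities.ResolutionOfSingularities.Theses.UniformComplexity.PrimeModelTransfer := by
  refine primeModelTransfer_of_climbAlgClosureFg fun p hp K _ _ _ s hM L _ _ _ _ X f hs hl hq hX => ?_
  let F : Subfield K := Subfield.closure (↑s : Set K)
  haveI : CharP (algebraicClosure F K) p :=
    (algebraMap (algebraicClosure F K) K).charP (algebraMap (algebraicClosure F K) K).injective p
  -- the finite level over `M = (closure s)^{alg} ∩ K` is free (`spreadOutRatFuncDimLe_top_top`)
  have hRat : ∀ (Y : Scheme.{0}) (g : Y ⟶ Spec (.of (RatFunc (algebraicClosure F K)))),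
      IsSeparated g → LocallyOfFiniteType g → QuasiCompact g → IsIntegral Y →
        Scheme.HasResolution Y := fun Y g hs' hl' hq' hY =>
    CampaignW82.spreadOutRatFuncDimLe_top_top p (algebraicClosure F K)
      (fun Z e hs'' hl'' hq'' hZ _ => hM Z e hs'' hl'' hq'' hZ) Y g hs' hl' hq' hY le_top
  exact hperf p hp K s hRat L X f hs hl hq hX

end Summit.ResolutionOfSingularities.ResolutionOfSingularities.Theorems.PrimeModelTransfer

end
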